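import Summits.ResolutionOfSingularities.ResolutionOfSingularities.Theorems.EquisingularLiftEquisingularLiftNatVertexChartForms
import Summits.ResolutionOfSingularities.ResolutionOfSingularities.Theorems.EquisingularLiftEquisingularLiftNatVertexChartOverlap
import Summits.ResolutionOfSingularities.ResolutionOfSingularities.Theorems.EquisingularLiftEquisingularLiftNatThreeLinesModel
import Literature.AlgebraicGeometry.Resolution.PointBlowupProjectionRingHom
import HarnessLib

/-!
# [OURS · L1 W4.5(b) · EL♮(3) · nose residue, (c) file 4b] STEINER'S THREE LINES IN ONE CHART, II: the common model `k[u₁,u₂][T]` IS the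
# vertex-chart ring `C₀` and the chart ring `(k[x]_{(x₀)})₀`; the three lines on both charts; the cover clause

Crux chain w45b, child EL♮(3) = stmt-ResolutionOfSingularities-20148; WIDTH seat res-L1-w45b-nose-w3 g3 (D-0157 DOOR 1), brick (c) = the
×3 UNION certificate `DirStepUnobs F₂ univ (⋃ i, vertexLineStrict υ i)` (027's (U1) recipe of record). `--supports stmt-ResolutionOfSingularities-20148
--as helper`. OURS; NOT a statement of any manuscript; AI-written, weaker than expert review. No `sorry`; standard axioms; DEF-FREE (identifications are
delivered by `∃`; the kit's local-instance attributes are needed to write `Proj k[x]` and the `k`-algebra `(k[x]_{(x₀)})₀`). Resolution in char `p` NOT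
proved here (dim 3: Cossart–Piltant 2008/2009 in print).

WHAT (`b : P̃ ⟶ ℙ³` ANY blowing up of the vertex; `c₀ = vertexChart hb 0 : Spec C₀ ⟶ P̃`; `cB` the lifted chart of `D₊(x₀)`; `q ∈ {(0,0),(1,0),(0,1)}`):
* ★ `exists_modelEquiv_chart` / ★ `exists_modelEquiv_away` — the model `MvPolynomial Unit (MvPolynomial (Fin 2) k)` of ✓ `…NatThreeLinesModel` is `C₀`
  (`uⱼ ↦ X_j/X₀`, `T ↦ X₀`) and `(k[x]_{(x₀)})₀` (`uⱼ ↦ x_j/x₀`, `T ↦ x₃/x₀`), constants to constants; `map_lineIdeal` — `𝔮_q ↦ (u₁ − q₁, u₂ − q₂)`.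
* `form_mem`, `algebraMap_dehomogenize_form` — the linear forms `x_j − a x₀` and their readings `X₀ · (X_j/X₀ − a)` on `Spec Cᵢ`.
* ★ `preimage_vertexChart_line` / ★ `preimage_lift_line` — on BOTH charts the strict transform of `V₊(x₁ − q₁x₀, x₂ − q₂x₀)` is `V(u₁ − q₁, u₂ − q₂)`
  (✓ `preimage_vertexChart_closure_pair` / ✓ `preimage_lift_closure_pair`; primality from ✓ `ThreeLines.isPrime_map_C_ker_eval`).
* `force_of_line`, `isClosed_line`, ★ `closure_line_subset_union` — **COVER**: each strict-transform line lies in `c₀(Spec C₀) ∪ b⁻¹D₊(x₀)`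
  (off `E` the point is over `D₊(x₀)`; on `E` it is moved into `Spec C₀` by ✓ `vertexChart_mem_opensRange_of_frac_notMem`).

References (index only): R. Hartshorne (1977), I Thm. 3.4, II §7 [cite: Hartshorne1977]; The Stacks Project, Tags 0804, 02OS [cite: StacksProject];
A. J. de Jong (1996), proof of Lemma 4.11 [cite: DeJong1996].
-/

set_option linter.dupNamespace false -- mandated namespace `Summit.<Summit>.<Problem>` of this single-conjunct summit

noncomputable section

-- `Proj`/`ProjectiveSpectrum` carrier coercions under `instances` transparency (as in the chain's other chart files).
set_option backward.isDefEq.respectTransparency false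

open CategoryTheory AlgebraicGeometry TopologicalSpace HomogeneousLocalization Topology MvPolynomial
open Literature.AlgebraicGeometry.Resolution Literature.AlgebraicGeometry.Resolution.DeJong1996
open Literature.AlgebraicGeometry.Resolution.PointBlowup (Chart Base frac exc polyEquiv polyHom baseHom)
open Literature.AlgebraicGeometry.Motives.Segre (grading X_mem chartι)
open AlgebraicGeometry.Scheme.IdealSheafData

attribute [local instance] MvPolynomial.gradedAlgebra Literature.AlgebraicGeometry.Motives.ProjBaseChange.algebraBase
  Literature.AlgebraicGeometry.Motives.ProjBaseChange.isScalarTower_localization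

namespace Summit.ResolutionOfSingularities.ResolutionOfSingularities.Cruxes.EquisingularLiftNat.Sections

namespace ThreeLines

variable {k : Type} [Field k]

/-! ## The model `k[u₁,u₂][T]` is the ring of both charts -/

/-- ★ **The vertex-chart ring `C₀ = k[X₀,X₁,X₂][I/X₀]` is the model `k[u₁,u₂][T]`** (`u₁ ↦ X₁/X₀`, `u₂ ↦ X₂/X₀`, `T ↦ X₀`, constants to constants;
`PointBlowup.polyEquiv` after renaming the base variables). [cite: DeJong1996, proof of Lemma 4.11] (OURS bookkeeping) -/
theorem exists_modelEquiv_chart :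
    ∃ Φ : MvPolynomial Unit (MvPolynomial (Fin 2) k) ≃+* Chart 2 k 0,
      Φ (X ()) = exc 2 k 0 ∧ Φ (C (X 0)) = frac 2 k 0 1 ∧ Φ (C (X 1)) = frac 2 k 0 2 ∧ ∀ a : k, Φ (C (C a)) = algebraMap k (Chart 2 k 0) a := by
  let e : Fin 2 ≃ {j : Fin (2 + 1) // j ≠ 0} := finSuccAboveEquiv 0
  let Φ : MvPolynomial Unit (MvPolynomial (Fin 2) k) ≃+* Chart 2 k 0 :=
    (MvPolynomial.mapEquiv Unit (MvPolynomial.renameEquiv k e).toRingEquiv).trans (polyEquiv 2 k 0)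
  have hΦC : ∀ p : MvPolynomial (Fin 2) k, Φ (C p) = baseHom 2 k 0 (MvPolynomial.rename e p) := fun p => by
    change polyEquiv 2 k 0 (MvPolynomial.map (MvPolynomial.renameEquiv k e).toRingEquiv.toRingHom (C p)) = _
    rw [MvPolynomial.map_C, PointBlowup.polyEquiv_apply, PointBlowup.polyHom_C]
    rfl
  refine ⟨Φ, ?_, ?_, ?_, fun a => ?_⟩
  · change polyEquiv 2 k 0 (MvPolynomial.map (MvPolynomial.renameEquiv k e).toRingEquiv.toRingHom (X ())) = _
    rw [MvPolynomial.map_X, PointBlowup.polyEquiv_apply, PointBlowup.polyHom_X]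
  · rw [hΦC, MvPolynomial.rename_X, PointBlowup.baseHom_X]; rfl
  · rw [hΦC, MvPolynomial.rename_X, PointBlowup.baseHom_X]; rfl
  · rw [hΦC, MvPolynomial.rename_C, PointBlowup.baseHom_C]

/-- ★ **The chart ring `(k[x₀,…,x₃]_{(x₀)})₀` is the model `k[u₁,u₂][T]`** (`u₁ ↦ x₁/x₀`, `u₂ ↦ x₂/x₀`, `T ↦ x₃/x₀`, constants to constants;
Mathlib `sumAlgEquiv`, a renaming `Unit ⊕ Fin 2 ≃ Fin 3`, and the tree's `chartAlgEquiv`). [cite: Hartshorne1977, I Thm. 3.4 (proof)] (OURS bookkeeping) -/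
theorem exists_modelEquiv_away :
    ∃ Φ : MvPolynomial Unit (MvPolynomial (Fin 2) k) ≃+* Away (grading (Fin (2 + 1 + 1)) k) (X (Fin.castSucc (0 : Fin (2 + 1)))),
      Φ (X ()) = Literature.AlgebraicGeometry.Motives.Segre.frac k (Fin.castSucc (0 : Fin (2 + 1))) (Fin.last (2 + 1)) ∧
      Φ (C (X 0)) = Literature.AlgebraicGeometry.Motives.Segre.frac k (Fin.castSucc (0 : Fin (2 + 1))) (Fin.castSucc (1 : Fin (2 + 1))) ∧
      Φ (C (X 1)) = Literature.AlgebraicGeometry.Motives.Segre.frac k (Fin.castSucc (0 : Fin (2 + 1))) (Fin.castSucc (2 : Fin (2 + 1))) ∧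
      ∀ a : k, Φ (C (C a)) = algebraMap k _ a := by
  let e₃ : Unit ⊕ Fin 2 ≃ Fin (2 + 1) :=
    (Equiv.sumComm Unit (Fin 2)).trans ((Equiv.sumCongr (Equiv.refl (Fin 2)) finOneEquiv.symm).trans finSumFinEquiv)
  have he₃l : e₃ (Sum.inl ()) = 2 := by decide
  have he₃r0 : e₃ (Sum.inr 0) = 0 := by decide
  have he₃r1 : e₃ (Sum.inr 1) = 1 := by decide
  let Φ : MvPolynomial Unit (MvPolynomial (Fin 2) k) ≃ₐ[k] Away (grading (Fin (2 + 1 + 1)) k) (X (0 : Fin (2 + 1 + 1))) :=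
    (MvPolynomial.sumAlgEquiv k Unit (Fin 2)).symm.trans ((MvPolynomial.renameEquiv k e₃).trans
      (Literature.AlgebraicGeometry.Motives.ProjectiveSpace.chartAlgEquiv k (0 : Fin (2 + 1 + 1))).symm)
  have hgen : ∀ j : Fin (2 + 1), (Literature.AlgebraicGeometry.Motives.ProjectiveSpace.chartAlgEquiv k (0 : Fin (2 + 1 + 1))).symm (X j) =
      Literature.AlgebraicGeometry.Motives.Segre.frac k (0 : Fin (2 + 1 + 1)) ((0 : Fin (2 + 1 + 1)).succAbove j) := fun j => by
    rw [Literature.AlgebraicGeometry.Motives.ProjectiveSpace.chartAlgEquiv_symm_X, ← PointBlowup.frac_succAbove_eq_chartGen]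
  refine ⟨Φ.toRingEquiv, ?_, ?_, ?_, fun a => ?_⟩
  · change (Literature.AlgebraicGeometry.Motives.ProjectiveSpace.chartAlgEquiv k (0 : Fin (2 + 1 + 1))).symm
      (MvPolynomial.rename e₃ ((MvPolynomial.sumAlgEquiv k Unit (Fin 2)).symm (X ()))) = _
    rw [MvPolynomial.sumAlgEquiv_symm_X, MvPolynomial.rename_X, he₃l, hgen]; rfl
  · change (Literature.AlgebraicGeometry.Motives.ProjectiveSpace.chartAlgEquiv k (0 : Fin (2 + 1 + 1))).symm
      (MvPolynomial.rename e₃ ((MvPolynomial.sumAlgEquiv k Unit (Fin 2)).symm (C (X 0)))) = _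
    rw [MvPolynomial.sumAlgEquiv_symm_C_X, MvPolynomial.rename_X, he₃r0, hgen]; rfl
  · change (Literature.AlgebraicGeometry.Motives.ProjectiveSpace.chartAlgEquiv k (0 : Fin (2 + 1 + 1))).symm
      (MvPolynomial.rename e₃ ((MvPolynomial.sumAlgEquiv k Unit (Fin 2)).symm (C (X 1)))) = _
    rw [MvPolynomial.sumAlgEquiv_symm_C_X, MvPolynomial.rename_X, he₃r1, hgen]; rfl
  · have h : (C (C a) : MvPolynomial Unit (MvPolynomial (Fin 2) k)) = algebraMap k _ a := rfl
    rw [h]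
    exact Φ.commutes a

/-- **Where the line ideals go**: for ANY ring identification `Φ` of the model with a `k`-algebra sending `u₁, u₂` to `v₁, v₂` and constants to
constants, `Φ(𝔮_q) = (v₁ − q₁, v₂ − q₂)`. [folklore] -/
theorem map_lineIdeal {S : Type} [CommRing S] [Algebra k S] (Φ : MvPolynomial Unit (MvPolynomial (Fin 2) k) ≃+* S) {v₁ v₂ : S}
    (h₁ : Φ (C (X 0)) = v₁) (h₂ : Φ (C (X 1)) = v₂) (hc : ∀ a : k, Φ (C (C a)) = algebraMap k S a) (q : Fin 2 → k) :
    ((RingHom.ker (eval q : MvPolynomial (Fin 2) k →+* k)).map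
        (C : MvPolynomial (Fin 2) k →+* MvPolynomial Unit (MvPolynomial (Fin 2) k))).map Φ =
      Ideal.span {v₁ - algebraMap k S (q 0), v₂ - algebraMap k S (q 1)} := by
  rw [map_C_ker_eval_eq_span, Ideal.map_span, Set.image_pair, map_sub, map_sub, map_sub, map_sub, h₁, h₂, hc, hc]

/-! ## The three lines on the two charts of a blowing up of the vertex -/

section Charts

variable {P : Scheme.{0}} (b : P ⟶ Proj (grading (Fin (2 + 1 + 1)) k)) (hb : IsBlowup b (vertexIdealSheaf 2 k))

/-- The two forms `x₁ − q₁x₀`, `x₂ − q₂x₀` are linear. [folklore] -/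
theorem form_mem (a : k) (j : Fin (2 + 1 + 1)) : (X j - C a * X 0 : MvPolynomial (Fin (2 + 1 + 1)) k) ∈ grading (Fin (2 + 1 + 1)) k 1 :=
  (isHomogeneous_X k j).sub (isHomogeneous_C_mul_X a 0)

/-- Dehomogenising `x_j − a x₀` in `x₃` and reading it in `Cᵢ`: `Xᵢ · (X_j/Xᵢ − a · X₀/Xᵢ)`. [folklore] -/
theorem algebraMap_dehomogenize_form (i : Fin (2 + 1)) (a : k) (j : Fin (2 + 1)) :
    algebraMap (MvPolynomial (Fin (2 + 1)) k) (Chart 2 k i)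
        (Literature.AlgebraicGeometry.Motives.ProjectiveSpace.dehomogenize k (Fin.last (2 + 1))
          (X (Fin.castSucc j) - C a * X 0 : MvPolynomial (Fin (2 + 1 + 1)) k)) =
      exc 2 k i * (frac 2 k i j - algebraMap k (Chart 2 k i) a * frac 2 k i 0) := by
  have h0 : (0 : Fin (2 + 1 + 1)) = (Fin.last (2 + 1)).succAbove 0 := by decide
  rw [h0, ← Fin.succAbove_last, map_sub, map_mul, MvPolynomial.algHom_C,
    Literature.AlgebraicGeometry.Motives.ProjectiveSpace.dehomogenize_X_succAbove,
    Literature.AlgebraicGeometry.Motives.ProjectiveSpace.dehomogenize_X_succAbove, map_sub, map_mul,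
    PointBlowup.algebraMap_X, PointBlowup.algebraMap_X, ← IsScalarTower.algebraMap_apply]
  ring

include hb in
/-- ★ **On the vertex chart `Spec C₀` the strict transform of `V₊(x₁ − q₁x₀, x₂ − q₂x₀)` is `V(X₁/X₀ − q₁, X₂/X₀ − q₂)`** (`q ∈ {(0,0),(1,0),(0,1)}`).
[cite: Hartshorne1977, II §7] (OURS computation; primality of the ideal from the model ✓ `ThreeLines.isPrime_map_C_ker_eval`) -/
theorem preimage_vertexChart_line (q : Fin 2 → k) :
    (vertexChart hb 0) ⁻¹' closure (b ⁻¹' ({y : Proj (grading (Fin (2 + 1 + 1)) k) |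
        (X 1 - C (q 0) * X 0 : MvPolynomial (Fin (2 + 1 + 1)) k) ∈ y.asHomogeneousIdeal ∧
        (X 2 - C (q 1) * X 0 : MvPolynomial (Fin (2 + 1 + 1)) k) ∈ y.asHomogeneousIdeal} \ {vertex 2 k})) =
      PrimeSpectrum.zeroLocus (Ideal.span {frac 2 k 0 1 - algebraMap k (Chart 2 k 0) (q 0),
        frac 2 k 0 2 - algebraMap k (Chart 2 k 0) (q 1)} : Set (Chart 2 k 0)) := by
  obtain ⟨Φ, hΦT, hΦ0, hΦ1, hΦc⟩ := exists_modelEquiv_chart (k := k)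
  have hmap := map_lineIdeal Φ hΦ0 hΦ1 hΦc q
  have hprime : (Ideal.span {frac 2 k 0 1 - algebraMap k (Chart 2 k 0) (q 0), frac 2 k 0 2 - algebraMap k (Chart 2 k 0) (q 1)} :
      Ideal (Chart 2 k 0)).IsPrime := by
    rw [← hmap]
    haveI := isPrime_map_C_ker_eval (k := k) q
    exact Ideal.map_isPrime_of_equiv Φ
  have hexc : exc 2 k 0 ∉ (Ideal.span {frac 2 k 0 1 - algebraMap k (Chart 2 k 0) (q 0), frac 2 k 0 2 - algebraMap k (Chart 2 k 0) (q 1)} :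
      Ideal (Chart 2 k 0)) := by
    rw [← hmap, ← hΦT]
    intro h
    have h' := Ideal.symm_apply_mem_of_equiv_iff.mpr h
    rw [RingEquiv.symm_apply_apply] at h'
    exact X_notMem_map_C_ker_eval q h'
  have h1 := algebraMap_dehomogenize_form (k := k) 0 (q 0) 1
  have h2 := algebraMap_dehomogenize_form (k := k) 0 (q 1) 2
  rw [PointBlowup.frac_self, mul_one] at h1 h2
  exact preimage_vertexChart_closure_pair hb 0 zero_lt_one zero_lt_one (form_mem (q 0) 1) (form_mem (q 1) 2) h1 h2 hprime hexc

variable (cB : Spec (.of (Away (grading (Fin (2 + 1 + 1)) k) (MvPolynomial.X (Fin.castSucc (0 : Fin (2 + 1)))))) ⟶ P)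
  (hcB : cB ≫ b = chartι k (Fin.castSucc (0 : Fin (2 + 1))))

include hcB in
/-- ★ **On the lifted chart `D₊(x₀)` the strict transform of `V₊(x₁ − q₁x₀, x₂ − q₂x₀)` is `V(x₁/x₀ − q₁, x₂/x₀ − q₂)`.** [cite: Hartshorne1977, II §7]
(OURS computation) -/
theorem preimage_lift_line (q : Fin 2 → k) :
    cB ⁻¹' closure (b ⁻¹' ({y : Proj (grading (Fin (2 + 1 + 1)) k) |
        (X 1 - C (q 0) * X 0 : MvPolynomial (Fin (2 + 1 + 1)) k) ∈ y.asHomogeneousIdeal ∧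
        (X 2 - C (q 1) * X 0 : MvPolynomial (Fin (2 + 1 + 1)) k) ∈ y.asHomogeneousIdeal} \ {vertex 2 k})) =
      PrimeSpectrum.zeroLocus (Ideal.span {Literature.AlgebraicGeometry.Motives.Segre.frac k (Fin.castSucc (0 : Fin (2 + 1)))
          (Fin.castSucc (1 : Fin (2 + 1))) - algebraMap k _ (q 0),
        Literature.AlgebraicGeometry.Motives.Segre.frac k (Fin.castSucc (0 : Fin (2 + 1))) (Fin.castSucc (2 : Fin (2 + 1))) -
          algebraMap k _ (q 1)} : Set _) := by
  rw [preimage_lift_closure_pair b 0 cB hcB zero_lt_one zero_lt_one (form_mem (q 0) 1) (form_mem (q 1) 2), PrimeSpectrum.zeroLocus_span]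
  have comp : ∀ (a : k) (j : Fin (2 + 1 + 1)) (j' : Fin (2 + 1)) (hj : j = (Fin.castSucc (0 : Fin (2 + 1))).succAbove j')
      (hF : (X j - C a * X 0 : MvPolynomial (Fin (2 + 1 + 1)) k) ∈ grading (Fin (2 + 1 + 1)) k 1),
      Away.isLocalizationElem (X_mem k (Fin.castSucc (0 : Fin (2 + 1)))) hF =
        Literature.AlgebraicGeometry.Motives.Segre.frac k (Fin.castSucc (0 : Fin (2 + 1))) j - algebraMap k _ a := by
    intro a j j' hj hF
    rw [Literature.AlgebraicGeometry.Motives.ProjectiveSpace.isLocalizationElem_X]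
    have h0 : (0 : Fin (2 + 1 + 1)) = Fin.castSucc (0 : Fin (2 + 1)) := rfl
    conv_lhs => rw [hj, h0]
    rw [map_sub, map_mul, MvPolynomial.algHom_C, Literature.AlgebraicGeometry.Motives.ProjectiveSpace.dehomogenize_X_succAbove,
      Literature.AlgebraicGeometry.Motives.ProjectiveSpace.dehomogenize_X_self, mul_one, map_sub,
      AlgHom.commutes, Literature.AlgebraicGeometry.Motives.ProjectiveSpace.toChart, MvPolynomial.aeval_X,
      ← PointBlowup.frac_succAbove_eq_chartGen, ← hj]
  rw [comp (q 0) 1 0 (by decide), comp (q 1) 2 1 (by decide)]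
  rfl

/-! ## The cover clause: the three strict-transform lines lie in `c₀(Spec C₀) ∪ b⁻¹D₊(x₀)` -/

/-- `x₁ − q₁x₀, x₂ − q₂x₀, x₀ ∈ y` force `x₀, x₁, x₂ ∈ y`. [folklore] -/
theorem force_of_line (q : Fin 2 → k) (y : Proj (grading (Fin (2 + 1 + 1)) k))
    (h₁ : (X 1 - C (q 0) * X 0 : MvPolynomial (Fin (2 + 1 + 1)) k) ∈ y.asHomogeneousIdeal)
    (h₂ : (X 2 - C (q 1) * X 0 : MvPolynomial (Fin (2 + 1 + 1)) k) ∈ y.asHomogeneousIdeal)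
    (h₀ : (X (Fin.castSucc (0 : Fin (2 + 1))) : MvPolynomial (Fin (2 + 1 + 1)) k) ∈ y.asHomogeneousIdeal) (j : Fin (2 + 1)) :
    (X (Fin.castSucc j) : MvPolynomial (Fin (2 + 1 + 1)) k) ∈ y.asHomogeneousIdeal := by
  have h₀' : (X 0 : MvPolynomial (Fin (2 + 1 + 1)) k) ∈ y.asHomogeneousIdeal := h₀
  fin_cases j
  · exact h₀
  · have e : (X 1 : MvPolynomial (Fin (2 + 1 + 1)) k) = (X 1 - C (q 0) * X 0) + C (q 0) * X 0 := by ring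
    change (X 1 : MvPolynomial (Fin (2 + 1 + 1)) k) ∈ y.asHomogeneousIdeal
    rw [e]
    exact Ideal.add_mem _ h₁ (Ideal.mul_mem_left _ _ h₀')
  · have e : (X 2 : MvPolynomial (Fin (2 + 1 + 1)) k) = (X 2 - C (q 1) * X 0) + C (q 1) * X 0 := by ring
    change (X 2 : MvPolynomial (Fin (2 + 1 + 1)) k) ∈ y.asHomogeneousIdeal
    rw [e]
    exact Ideal.add_mem _ h₂ (Ideal.mul_mem_left _ _ h₀')

/-- The line `V₊(x₁ − q₁x₀, x₂ − q₂x₀)` is closed. [folklore] -/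
theorem isClosed_line (q : Fin 2 → k) :
    IsClosed {y : Proj (grading (Fin (2 + 1 + 1)) k) |
        (X 1 - C (q 0) * X 0 : MvPolynomial (Fin (2 + 1 + 1)) k) ∈ y.asHomogeneousIdeal ∧
        (X 2 - C (q 1) * X 0 : MvPolynomial (Fin (2 + 1 + 1)) k) ∈ y.asHomogeneousIdeal} := by
  have h : {y : Proj (grading (Fin (2 + 1 + 1)) k) |
        (X 1 - C (q 0) * X 0 : MvPolynomial (Fin (2 + 1 + 1)) k) ∈ y.asHomogeneousIdeal ∧
        (X 2 - C (q 1) * X 0 : MvPolynomial (Fin (2 + 1 + 1)) k) ∈ y.asHomogeneousIdeal} =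
      ((Proj.basicOpen (grading (Fin (2 + 1 + 1)) k) (X 1 - C (q 0) * X 0 : MvPolynomial (Fin (2 + 1 + 1)) k) : Set _)ᶜ) ∩
        (Proj.basicOpen (grading (Fin (2 + 1 + 1)) k) (X 2 - C (q 1) * X 0 : MvPolynomial (Fin (2 + 1 + 1)) k) : Set _)ᶜ := by
    ext y
    simp only [Set.mem_setOf_eq, Set.mem_inter_iff, Set.mem_compl_iff, SetLike.mem_coe, Proj.mem_basicOpen, not_not]
  rw [h]
  exact (Proj.basicOpen _ _).isOpen.isClosed_compl.inter (Proj.basicOpen _ _).isOpen.isClosed_compl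

include hb in
/-- ★ **COVER: the strict transform of `V₊(x₁ − q₁x₀, x₂ − q₂x₀)`, `q ∈ {(0,0),(1,0),(0,1)}`, lies in `c₀(Spec C₀) ∪ b⁻¹D₊(x₀)`** — off the
exceptional divisor the point lies over `D₊(x₀)` (`force_of_line`); a point of the exceptional divisor seen on the chart `Spec C_j`, `j = 1, 2`, has
`X₀/X_j − 1 ∈ 𝔭` (`mem_of_mem_preimage_closure_pair`), so `X₀/X_j ∉ 𝔭` and ✓ `vertexChart_mem_opensRange_of_frac_notMem` moves it to `Spec C₀`.
[cite: StacksProject, Tag 0804] (OURS computation) -/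
theorem closure_line_subset_union (q : Fin 2 → k) (hq : q = ![0, 0] ∨ q = ![1, 0] ∨ q = ![0, 1]) :
    closure (b ⁻¹' ({y : Proj (grading (Fin (2 + 1 + 1)) k) |
        (X 1 - C (q 0) * X 0 : MvPolynomial (Fin (2 + 1 + 1)) k) ∈ y.asHomogeneousIdeal ∧
        (X 2 - C (q 1) * X 0 : MvPolynomial (Fin (2 + 1 + 1)) k) ∈ y.asHomogeneousIdeal} \ {vertex 2 k})) ⊆
      ((vertexChart hb 0).opensRange : Set P) ∪
        ((b ⁻¹ᵁ Proj.basicOpen (grading (Fin (2 + 1 + 1)) k) (MvPolynomial.X (Fin.castSucc (0 : Fin (2 + 1)))) : P.Opens) : Set P) := by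
  intro z hz
  -- the point lies over the (closed) line
  have hzL : b z ∈ {y : Proj (grading (Fin (2 + 1 + 1)) k) |
        (X 1 - C (q 0) * X 0 : MvPolynomial (Fin (2 + 1 + 1)) k) ∈ y.asHomogeneousIdeal ∧
        (X 2 - C (q 1) * X 0 : MvPolynomial (Fin (2 + 1 + 1)) k) ∈ y.asHomogeneousIdeal} :=
    closure_minimal (Set.preimage_mono Set.sdiff_subset) ((isClosed_line q).preimage b.continuous) hz
  have hoff : b z ≠ vertex 2 k →
      z ∈ ((b ⁻¹ᵁ Proj.basicOpen (grading (Fin (2 + 1 + 1)) k) (MvPolynomial.X (Fin.castSucc (0 : Fin (2 + 1)))) : P.Opens) : Set P) :=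
    fun hne => mem_basicOpen_of_mem_pair 0 (fun y h₁ h₂ h₀ => force_of_line q y h₁ h₂ h₀) hzL.1 hzL.2 hne
  rcases mem_preimage_basicOpen_or_mem_opensRange hb z with ⟨j, hj⟩ | ⟨j, hj⟩
  · exact Or.inr (hoff fun h => vertex_notMem_basicOpen 2 k j (h ▸ hj))
  · obtain ⟨𝔭, rfl⟩ := hj
    by_cases hE : exc 2 k j ∈ 𝔭.asIdeal
    · left
      -- on the exceptional divisor: read the line on the chart `Spec C_j`
      have hg := mem_of_mem_preimage_closure_pair hb j zero_lt_one zero_lt_one (form_mem (q 0) 1) (form_mem (q 1) 2)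
        (algebraMap_dehomogenize_form j (q 0) 1) (algebraMap_dehomogenize_form j (q 1) 2) hz
      have h1 : (1 : Chart 2 k j) ∉ 𝔭.asIdeal := fun h => 𝔭.2.ne_top ((Ideal.eq_top_iff_one _).mpr h)
      have hj3 : j = 0 ∨ j = 1 ∨ j = 2 := by fin_cases j <;> simp
      rcases hj3 with rfl | rfl | rfl
      · exact ⟨𝔭, rfl⟩
      · -- `j = 1`: `1 − q₁ · X₀/X₁ ∈ 𝔭`
        have hg1 := hg.1
        rw [PointBlowup.frac_self] at hg1
        rcases hq with rfl | rfl | rfl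
        · change 1 - algebraMap k (Chart 2 k 1) 0 * frac 2 k 1 0 ∈ 𝔭.asIdeal at hg1
          rw [map_zero, zero_mul, sub_zero] at hg1
          exact absurd hg1 h1
        · change 1 - algebraMap k (Chart 2 k 1) 1 * frac 2 k 1 0 ∈ 𝔭.asIdeal at hg1
          rw [map_one, one_mul] at hg1
          refine vertexChart_mem_opensRange_of_frac_notMem hb 1 0 𝔭 fun h => h1 ?_
          have e : (1 : Chart 2 k 1) = (1 - frac 2 k 1 0) + frac 2 k 1 0 := by ring
          rw [e]
          exact Ideal.add_mem _ hg1 h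
        · change 1 - algebraMap k (Chart 2 k 1) 0 * frac 2 k 1 0 ∈ 𝔭.asIdeal at hg1
          rw [map_zero, zero_mul, sub_zero] at hg1
          exact absurd hg1 h1
      · -- `j = 2`: `1 − q₂ · X₀/X₂ ∈ 𝔭`
        have hg2 := hg.2
        rw [PointBlowup.frac_self] at hg2
        rcases hq with rfl | rfl | rfl
        · change 1 - algebraMap k (Chart 2 k 2) 0 * frac 2 k 2 0 ∈ 𝔭.asIdeal at hg2
          rw [map_zero, zero_mul, sub_zero] at hg2
          exact absurd hg2 h1
        · change 1 - algebraMap k (Chart 2 k 2) 0 * frac 2 k 2 0 ∈ 𝔭.asIdeal at hg2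
          rw [map_zero, zero_mul, sub_zero] at hg2
          exact absurd hg2 h1
        · change 1 - algebraMap k (Chart 2 k 2) 1 * frac 2 k 2 0 ∈ 𝔭.asIdeal at hg2
          rw [map_one, one_mul] at hg2
          refine vertexChart_mem_opensRange_of_frac_notMem hb 2 0 𝔭 fun h => h1 ?_
          have e : (1 : Chart 2 k 2) = (1 - frac 2 k 2 0) + frac 2 k 2 0 := by ring
          rw [e]
          exact Ideal.add_mem _ hg2 h
    · exact Or.inr (hoff fun h => hE ((vertexChart_apply_eq_vertex_iff hb j 𝔭).mp h))


end Charts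
end ThreeLines

end Summit.ResolutionOfSingularities.ResolutionOfSingularities.Cruxes.EquisingularLiftNat.Sections

end
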